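import Mathlib.Tactic.Linarith
import Mathlib.Tactic.NormNum
import Mathlib.Tactic.Ring
import Mathlib.Tactic.IntervalCases
import HarnessLib

/-!
# The (0,1) cell of the ι-window, XXVII: the product ground `B₁ × B₂`, XIV — KL RANK 1 (the supports `E × B₂ ∪ B₁ × D` glued along
# `R = E × D`): the descent lemma, the class budgets, the rows `R_a` and `G0`, the pinning range (report [XXVII]): arithmetic shadows

Family `hodge`, b2b cell `hweil` (helper of item stmt-HodgeConjecture-2524). Report
`run/shared/lean/b2b/hodge-weil/b2b-hweil-pv1-g39/H2-ZERO-ONE-27.md` ([XXVII]); script `code/pv1-g39/r1_numerics.py`. Conventions of [XXV] 0.1: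
classes on `X₀ = B₁ × B₂` are `3 × 3` integer matrices in the basis `(1,θ₁,pt₁) ⊗ (1,θ₂,pt₂)`, the H2 reading is `W = [[0,2,2],[2,2,0],[2,0,−2]]`;
a rank-1 support is `E × B₂ ∪ B₁ × D` (`E`, `D` smooth members of `|2Θ₀|`, genus 5), glued along `R = E × D` (`K_R ≡ 8F_E + 8F_D`, `χ(𝒪_R) = 16`);
the two hulls are `M ⊠ N` (`deg M = m`, `N ≡ bθ₂`) and `M′ ⊠ N′` (`M′ ≡ aθ₁`, `deg N′ = n`). HONEST FRAMING: census results inside the ladder's H2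
test ((0,1) cell) on the SPECIAL fourfold `X₀ = B₁ × B₂`; nothing here is a rung; no case of the Hodge conjecture is proved; no statement of
[Markman 2025] / [Perry 2026] / [EdGFS 2025] is used. Every theorem below is a def-free arithmetic identity or inequality that the report cites at the
step named in its docstring; none claims geometry.
-/

-- mandated namespace `Summit.HodgeConjecture.HodgeConjecture.…` (Problem = Summit) trips `linter.dupNamespace`; the lakefile disables it
-- tree-wide (weak option), restated here so stand-alone elaboration is warning-free too.
set_option linter.dupNamespace false

namespace Summit.HodgeConjecture.HodgeConjecture.WeilTypeLadder

section ProductGroundFourteen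

/-- **[XXVII] 3.3 (the push-forward from the gluing surface), cross-check.** For a line bundle of class `αF_E + βF_D` on `R = E × D`:
Riemann–Roch `χ = 16 + (L² − L·K_R)/2` with `L² = 2αβ`, `L·K_R = 8α + 8β` gives `χ = (α − 4)(β − 4)` (stated doubled, division-free); and the
independent route `j_*(L|_R) = i_{1*}(M ⊠ N) − i_{1*}(M ⊠ N(−D))` reproduces the three entries: `2(b − (b−2)) = 4` (the class `[R] = 4θ₁θ₂`),
`2(b² − (b−2)²) = 2(4b − 4)` (the term `j_*(c₁ − K_R/2)` for `β = 4b`) and `(m−4)(b² − (b−2)²) = (m − 4)(4b − 4)` (`χ` for `α = m`). [`ring`] -/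
theorem pg14_gluing_surface_pushforward (α β m b : ℤ) :
    (2 * 16 + (2 * α * β - (8 * α + 8 * β)) = 2 * ((α - 4) * (β - 4))) ∧ (2 * (b - (b - 2)) = 4) ∧
    (2 * (b ^ 2 - (b - 2) ^ 2) = 2 * (4 * b - 4)) ∧ ((m - 4) * (b ^ 2 - (b - 2) ^ 2) = (m - 4) * (4 * b - 4)) := by
  refine ⟨by ring, by ring, by ring, by ring⟩

/-- **[XXVII] 3.4 (THE CLASS BUDGETS), case `r = 0`.** With `m = n = 6` and `a + b = 1` (`b = 1 − a`) the cosupport-plus-gluing must supply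
`(u, v, χ) = (2a + 2b², 2b + 2a², 2a² + 2b² + 2) = (2c, 2c, 4c)` with `c := a² − a + 1`; and `4c = (2a − 1)² + 3`, so `c ≥ 1` (`c` is odd
since `a² − a = a(a − 1)` is even — used in the text, not restated here). [`ring` / `nlinarith`] -/
theorem pg14_budgets_r0 (a : ℤ) :
    (2 * a + 2 * (1 - a) ^ 2 = 2 * (a ^ 2 - a + 1)) ∧ (2 * (1 - a) + 2 * a ^ 2 = 2 * (a ^ 2 - a + 1)) ∧
    (2 * a ^ 2 + 2 * (1 - a) ^ 2 + 2 = 4 * (a ^ 2 - a + 1)) ∧ (4 * (a ^ 2 - a + 1) = (2 * a - 1) ^ 2 + 3) ∧ (1 ≤ a ^ 2 - a + 1) := by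
  refine ⟨by ring, by ring, by ring, by ring, by nlinarith [sq_nonneg (2 * a - 1)]⟩

/-- **[XXVII] 3.6 (LEMMA D0: both components locally free along `R` ⇒ decomposable), the arithmetic end.** Off `R` the cosupport of `F₁` is
`E × ξ₁` (`u₁ = 2h₁`, `χ₁ ≥ 2h₁`) and that of `F₂` is `ξ₂ × D` (`v₂ = 2h₂`, `χ₂ ≥ 2h₂`); the budgets `u = v = 2c` give `h₁ = h₂ = c`, and then
`χ₁ + χ₂ + ℓ(𝒢) = 4c` with `χ_i = 2c + p_i`, `p_i, ℓ ≥ 0` forces `ℓ(𝒢) = 0 = p₁ = p₂`: the gluing module vanishes and `F = F₁ ⊕ F₂`. [`omega`] -/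
theorem pg14_D0_forces_no_gluing (c p₁ p₂ ℓ : ℤ) (h₁ : 0 ≤ p₁) (h₂ : 0 ≤ p₂) (hℓ : 0 ≤ ℓ)
    (hX : (2 * c + p₁) + (2 * c + p₂) + ℓ = 4 * c) : ℓ = 0 ∧ p₁ = 0 ∧ p₂ = 0 := by
  omega

/-- **[XXVII] 3.7 (no two-sided gluing curve at `r = 0`).** A two-sided component `Γ ⊂ E × D` of the gluing locus, of bidegree `(d_D, d_E) ≥ (1,1)`,
off the cosupports, carries the degree-zero condition `(6 − 4a)d_E + (4b − 6)d_D = 0`, `b = 1 − a`, i.e. `(3 − 2a)d_E = (1 + 2a)d_D`; this forces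
`a ∈ {0, 1}` (the two odd factors must have the same sign), and then `d_D = 3d_E ≥ 3` resp. `d_E = 3d_D ≥ 3` exceeds the budget `2c = 2`. Here: the
sign argument for all integers. [`nlinarith` / `omega`] -/
theorem pg14_twosided_gluing_degree (a dD dE : ℤ) (hD : 1 ≤ dD) (hE : 1 ≤ dE)
    (h : (3 - 2 * a) * dE = (1 + 2 * a) * dD) : (a = 0 ∧ dD = 3 * dE) ∨ (a = 1 ∧ dE = 3 * dD) := by
  have ha : ¬ (2 ≤ a) := by
    intro h2
    have h3 : (3 - 2 * a) * dE ≤ -dE := by nlinarith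
    have h4 : 5 * dD ≤ (1 + 2 * a) * dD := by nlinarith
    linarith
  have hb : ¬ (a ≤ -1) := by
    intro h2
    have h3 : 5 * dE ≤ (3 - 2 * a) * dE := by nlinarith
    have h4 : (1 + 2 * a) * dD ≤ -dD := by nlinarith
    linarith
  have h01 : a = 0 ∨ a = 1 := by omega
  rcases h01 with h0 | h1
  · left; subst h0; constructor; · rfl
    linarith
  · right; subst h1; constructor; · rfl
    linarith

/-- **[XXVII] 4.2 (LEMMA PIN, the range at `r = 1`).** With `b = 3 − a`, `d := 6 − 4a` (the common bidegree of `𝓛₁|_R ⊗ 𝓛₂|_R⁻¹`, never `0`,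
`≡ 2 (mod 4)`), the `v`-budget `2b + 2a² − 2(α_𝒢 − 4)` with `α_𝒢 = 6 − α(Δ₁) + α(τ)` against `v₁ ≥ 2α(Δ₁)`, `v₂ ≥ 2(α(Δ₁) − d)` gives
`α(Δ₁) + α(τ) ≤ b + a² − 2 + d = a² − 5a + 7`; the lower bound is `max(0, d)`; the width above `d` is `(a² − 5a + 7) − (6 − 4a) = a² − a + 1`.
[`ring` / `omega`] -/
theorem pg14_pin_range (a : ℤ) :
    ((3 - a) + a ^ 2 - 2 + (6 - 4 * a) = a ^ 2 - 5 * a + 7) ∧ ((a ^ 2 - 5 * a + 7) - (6 - 4 * a) = a ^ 2 - a + 1) ∧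
    (6 - 4 * a ≠ 0) ∧ ((6 - 4 * a) % 4 = 2) ∧
    (∀ α₁ τ v₁ v₂ : ℤ, 2 * α₁ ≤ v₁ → 2 * (α₁ - (6 - 4 * a)) ≤ v₂ → 0 ≤ τ →
        v₁ + v₂ = 2 * (3 - a) + 2 * a ^ 2 - 2 * ((6 - α₁ + τ) - 4) → α₁ + τ ≤ a ^ 2 - 5 * a + 7) := by
  refine ⟨by ring, by ring, by omega, by omega, ?_⟩
  intro α₁ τ v₁ v₂ h1 h2 h3 h4
  nlinarith

/-- **[XXVII] 4.3 (`Δ₂ = 0` and `Δ₁` exact for `a ∈ {0,1,2,3}`).** The width `a² − a + 1` (for `a ≤ 1`) resp. `a² − 5a + 7` (for `a ≥ 2`) equals `1`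
exactly for `a ∈ {0, 1}` resp. `{2, 3}` (and is `3` at `a = −1`, `4`); an ι-stable non-zero effective divisor on `R` has `α` even `≥ 2` (vertical
pairs), or `α ≥ 3` (two-sided, gonality), or `α = 0` with `β ≥ 2` — so a class with `α, β ≤ 1` is zero: `Δ₂ = 0` (for `a ≤ 1`; `Δ₁ = 0` for `a ≥ 2`)
and `Δ₁ ≡ (6 − 4a)(F_E + F_D)` on the nose. [`norm_num` / `omega`] -/
theorem pg14_delta_two_vanishes :
    ((0:ℤ) ^ 2 - 0 + 1 = 1) ∧ ((1:ℤ) ^ 2 - 1 + 1 = 1) ∧ ((2:ℤ) ^ 2 - 5 * 2 + 7 = 1) ∧ ((3:ℤ) ^ 2 - 5 * 3 + 7 = 1) ∧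
    ((-1:ℤ) ^ 2 - (-1) + 1 = 3) ∧ ((4:ℤ) ^ 2 - 5 * 4 + 7 = 3) ∧
    (∀ α : ℕ, α ≤ 1 → (α % 2 = 0 ∧ 2 ≤ α) ∨ 3 ≤ α ∨ α = 0 → α = 0) := by
  refine ⟨by norm_num, by norm_num, by norm_num, by norm_num, by norm_num, by norm_num, ?_⟩
  intro α h1 h2; omega

/-- **[XXVII] 4.4 (THE ROWS `R_a`; EXAMPLE G1 is `a = 1`), `ch = W` for every integer `a`.** With `b = 3 − a`, `k = 3 − 2a` vertical and
horizontal PAIRS in the cross `K ⊂ R` (so `K ≡ 2k(F_E + F_D)`), `c = a² − a + 1`, `deg M = 4a + 2k`, `deg N′ = 4b − 2k`: (i) `deg M = deg N′ = 6`;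
(ii) `χ(𝓛₁|_K)` by components-minus-nodes, `2k(4b − 4) + 2k(m − 4) − 4k²`, equals the Cartier route `(m−4)(4b−4) − (m−2k−4)(4b−2k−4)`, both
`= 8k`; (iii) the entries of `ch F = ch 𝓛₁ − [K] − [E × Ξ₂] + ch 𝓛₂ − [Ξ₁ × D] − ch j_*(𝓛₂|_R)`: `(θ₁,θ₂)`: `2b + 2a − 4 = 2`; `(θ₁,pt₂)`:
`2b² − 4k − 2c + 2a − 4 = 0`; `(pt₁,θ₂)`: `2b − 4k + 2a² − 2c − (8a − 8) = 0`; `(pt₁,pt₂)`: `2b² − 8k − 2c + 2a² − 2c − (8a − 8) = −2` — i.e.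
`ch F = W`. (Script `r1_numerics.py` PART D prints the same for `a ∈ [−5, 1]`.) [`ring`] -/
theorem pg14_rows_Ra (a : ℤ) :
    let b := 3 - a; let k := 3 - 2 * a; let c := a ^ 2 - a + 1; let m := 4 * a + 2 * k; let n := 4 * b - 2 * k
    (m = 6) ∧ (n = 6) ∧
    (2 * k * (4 * b - 4) + 2 * k * (m - 4) - 4 * k ^ 2 = 8 * k) ∧ ((m - 4) * (4 * b - 4) - (m - 2 * k - 4) * (4 * b - 2 * k - 4) = 8 * k) ∧
    (2 * b + 2 * a - 4 = 2) ∧ (2 * b ^ 2 - 4 * k - 2 * c + 2 * a - 4 = 0) ∧ (2 * b - 4 * k + 2 * a ^ 2 - 2 * c - (8 * a - 8) = 0) ∧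
    (2 * b ^ 2 - 8 * k - 2 * c + 2 * a ^ 2 - 2 * c - (8 * a - 8) = -2) := by
  refine ⟨by ring, by ring, by ring, by ring, by ring, by ring, by ring, by ring⟩

/-- **[XXVII] 4.4 / 3.8 (EXAMPLE G1 and the rows G0/G0′, the small numbers).** G1 (`a = 1`, `b = 2`): `χ(𝓛₁|_K) = 2(8 − 4) + 2(6 − 4) − 4 = 8`,
the torsion-free gluing sheaf `𝒩 = 𝓛₁|_R(−K) ≡ 4F_E + 6F_D` has `χ = (4−4)(6−4) = 0`, and the budget `2·1 + 2·4 + 2 = 12` leaves `12 − 8 − 0 = 4`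
`= χ({w₁} × D) + χ(E × {w₂}) = 2 + 2`. G0 (`r = 0`, `a = 0`, `b = 1`): the theta-translate pairs cost `χ = 2(2b − 1) = 2` in `Z₁` and
`2(2a − 1) = −2` in `Z₂`, the `(pt₁,pt₂)` entry before points is `2b² − 2 + 2a² + 2 = 2`, so points plus `ℓ(𝒢)` total `2 − (−2) = 4`, and an
ι-stable finite gluing off the (empty) fixed locus has EVEN positive length: `ℓ ∈ {2, 4}`. [`norm_num` / `omega`] -/
theorem pg14_example_G1_G0 :
    (2 * (8 - 4) + 2 * (6 - 4) - 4 = (8:ℤ)) ∧ ((4 - 4) * (6 - 4) = (0:ℤ)) ∧ (2 * 1 + 2 * 4 + 2 = (12:ℤ)) ∧ (12 - 8 - 0 = (2:ℤ) + 2) ∧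
    (2 * (2 * 1 - 1) = (2:ℤ)) ∧ (2 * (2 * 0 - 1) = (-2:ℤ)) ∧ (2 * 1 ^ 2 - 2 + 2 * 0 ^ 2 + 2 = (2:ℤ)) ∧ (2 - (-2) = (4:ℤ)) ∧
    (∀ ℓ : ℕ, ℓ % 2 = 0 → 1 ≤ ℓ → ℓ ≤ 4 → ℓ = 2 ∨ ℓ = 4) := by
  refine ⟨by norm_num, by norm_num, by norm_num, by norm_num, by norm_num, by norm_num, by norm_num, by norm_num, ?_⟩
  intro ℓ h1 h2 h3; omega

/-- **[XXVII] 3.9 (LEMMA FT, free twists) and 2.4 (PROPOSITION GEN), the parameter counts.** The ι-invariant identity component of `Pic⁰(E)` is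
`π^*Pic⁰(Ē)` of dimension `g(Ē) = 3` (Riemann–Hurwitz for the étale double cover: `2·5 − 2 = 2(2·3 − 2)`), likewise for `D`: the two twists give
`3 + 3 = 6 ≥ 2` invariant parameters; the support families have dimensions `3 + 3 = 6` (rank 1), `4 + 4 + 3 = 11` (rank 2), `16 − 1 − 1 = 14`
(rank 3: the determinant hypersurface of `ℙ¹⁵`), `16 − 1 = 15` (rank 4), all `≥ 2`; and the rows `R_a` move in `2k + 6 = 2(3 − 2a) + 6 ≥ 8`
parameters for `a ≤ 1`. [`norm_num` / `omega`] -/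
theorem pg14_parameter_counts :
    (2 * 5 - 2 = 2 * (2 * 3 - 2)) ∧ (3 + 3 = (6:ℕ)) ∧ (2 ≤ (6:ℕ)) ∧ (4 + 4 + 3 = (11:ℕ)) ∧ (16 - 1 - 1 = (14:ℕ)) ∧ (16 - 1 = (15:ℕ)) ∧
    (∀ a : ℤ, a ≤ 1 → 8 ≤ 2 * (3 - 2 * a) + 6) := by
  refine ⟨by norm_num, by norm_num, by norm_num, by norm_num, by norm_num, by norm_num, ?_⟩
  intro a ha; omega

/-- **[XXVII] 5.2 (the node axis: the conductor double cover), Euler bookkeeping ([XXVI] 7.2 recalled).** For a node axis `L₁ ∋ n_w`: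
`B̃₁ = Bl_{w, ±p₃, ±p₄}B₁`, `f₁² = 8 − 4 − 4 = 0`, the general member normalised at `w` has genus `5 − 1 = 4`, and `e(B̃₁) = 0 + 5 = 2·(2 − 2·4) + 15 + 2`
(15 nodal values, 2 tacnodal-reducible members); the conductor double cover `Ṽ_w → B̃₂` is branched along two disjoint smooth genus-5 members, so
`e(Ṽ_w) = 2·e(B̃₂) − 2·e(D) = 2·8 − 2·(−8) = 32`; over `V_w` the sheaf `ν_*𝒪_{Σ̃}` has rank `2`, so the gluing module of a generically invertible `F`
has rank `r = 2 − 1 = 1` there. [`norm_num`] -/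
theorem pg14_node_axis_euler :
    (8 - 4 - 4 = (0:ℤ)) ∧ (5 - 1 = (4:ℤ)) ∧ (2 * (2 - 2 * 4) + 15 + 2 = (5:ℤ)) ∧ (0 + 5 = (5:ℤ)) ∧
    (2 * 8 - 2 * (-8) = (32:ℤ)) ∧ (2 - 1 = (1:ℤ)) := by
  norm_num

end ProductGroundFourteen

end Summit.HodgeConjecture.HodgeConjecture.WeilTypeLadder
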